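import Mathlib.MeasureTheory.VectorMeasure.Integral
import Mathlib.MeasureTheory.VectorMeasure.Decomposition.Jordan
import Mathlib.MeasureTheory.VectorMeasure.WithDensity
import Mathlib.LinearAlgebra.Matrix.PosDef
import Mathlib.Analysis.InnerProductSpace.PiL2
import Mathlib.MeasureTheory.Function.LpSeminorm.CompareExp
import Mathlib.MeasureTheory.Measure.HasOuterApproxClosed
import Mathlib.MeasureTheory.Integral.BoundedContinuousFunction
import Literature.Analysis.FunctionSpaces.TorusTestFunction
import HarnessLib

/-!
# Reynolds (weak-*) defect measures of weakly convergent `L²` velocity fields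

When a sequence of velocity fields `u_n : T^d → ℝ^d` is bounded in `L²(T^d)` and converges
weakly in `L²` to `v`, the quadratic quantities `u_n ⊗ u_n dx` need not converge to `v ⊗ v dx`;
after extraction, `u_n ⊗ u_n dx ⇀* v ⊗ v dx + R` in the sense of measures, where the defect
`R = (R_ij)` is a finite, symmetric, positive-semidefinite matrix-valued Borel measure — the
*Reynolds stress* of the weak limit, `R = w-lim (u_n - v) ⊗ (u_n - v) dx ⪰ 0`
(De Lellis–Székelyhidi 2012, §2.2 "The Reynolds stress and subsolutions", and §2.4, the
concentration part `⟨θ⊗θ, ν^∞⟩ λ` of the generalized Young measure; DiPerna–Majda 1987, Thm. 1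
(generalized Young measure of an `L²`-bounded family) and (1.11)–(1.13); its trace
`tr R = w*-lim |u_n|² dx - |v|² dx` is the *weak-\* defect measure* `σ` of Majda–Bertozzi 2002,
§11.1, (11.18)–(11.20), whose vanishing characterises strong convergence, Prop. 11.1).
A pair `(v, R)` arising this way from (approximate) Euler/Navier–Stokes solutions is an
Euler–Reynolds *subsolution*: `div (v ⊗ v + R) + ∇p = f` weakly (De Lellis–Székelyhidi 2012,
§2.2, the averaged system for `(v̄, R)`, and Def. 2.3).

## Contents

* `MatrixMeasure d X = Matrix d d (SignedMeasure X)`: matrix-valued finite signed measures;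
  `MatrixMeasure.eval R A` the real matrix `(R i j A)`; `MatrixMeasure.IsPosSemidef R`: every
  `R.eval A` is positive semidefinite (Mathlib's `Matrix.PosSemidef`, which includes symmetry);
  `MatrixMeasure.pairing R G = ∑ i j ∫ G i j d(R i j)` (the duality `∫ G : dR` with a matrix field,
  Mathlib's integral `∫ᵛ · ∂<•s` against a signed measure); `MatrixMeasure.traceMass R = ∑ i R i i univ`.
* `Torus.IsReynoldsDefectOf u v R` (the definition requested by route
  AnomalousDissipation/SteadyWeakLimit, item WeakLimitSubsolution): `R` is positive semidefinite
  and, for every continuous `φ : T^d → ℝ` and all `i j`,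
  `∫ φ (u_n)_i (u_n)_j dx → ∫ φ v_i v_j dx + ∫ φ d(R i j)`.
* `Torus.defectPairing R w = ∫ ∇w : dR = ∑ i j ∫ ∂ⱼ wᵢ d(R i j)`, the term by which a measure
  Reynolds stress enters the weak momentum balance, and
  `Torus.IsSteadyEulerReynoldsSubsolution f v R`, the weak stationary Euler–Reynolds system
  `div (v ⊗ v + R) + ∇p = f`, `div v = 0` on `T^d` with measure-valued stress.
* Proved API: symmetry and positivity consequences of `IsPosSemidef`; finiteness of the
  variation of a signed measure (so that constants integrate: `∫ 1 d(R i i) = R i i univ`);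
  a finite signed Borel measure on a metrizable space is determined by the integrals of bounded
  continuous functions (`MatrixMeasure.signedMeasure_ext_of_forall_integral_eq`), hence the
  Reynolds defect is determined by the sequence and `v` (`Torus.IsReynoldsDefectOf.unique`);
  integration against a real density (`MatrixMeasure.signedMeasure_integral_withDensityᵥ`,
  `pairing_ofDensity`) and consistency of `defectPairing` with the classical column-stored stress
  term of `Torus.IsEulerReynoldsOn` (`Torus.defectPairing_ofDensity`); the energy-defect identity
  `∫ |u_n|² → ∫ |v|² + tr R (T^d)` (`Torus.IsReynoldsDefectOf.tendsto_integral_norm_sq`,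
  Majda–Bertozzi (11.16)–(11.18)); the zero defect of a constant sequence.
* Named fact (not proved here): `Torus.exists_isReynoldsDefectOf_subseq`, existence of `R` along
  a subsequence of any `L²`-bounded weakly convergent sequence (DiPerna–Majda 1987, Thm. 1).

## Design choices

* Carrier: a `d × d` matrix of Mathlib signed measures (finite by definition of
  `SignedMeasure`; Borel since `UnitAddTorus d` carries its Borel σ-algebra), exactly the
  "matrix-valued measure" of the sources; positive semidefiniteness is required setwise,
  `∀ A, (R i j A)_{ij} ⪰ 0`, which for finite signed measures is equivalent to
  `∑ ξ_i ξ_j R i j ⪰ 0` as measures for every `ξ ∈ ℝ^d`.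
* Test functions are all continuous `φ : T^d → ℝ` (`T^d` is compact, so these are the bounded
  continuous functions and the convergence is weak-\* convergence in `C(T^d)^* = M(T^d)`).
* The predicate does not itself assert `u_n ⇀ v` weakly in `L²` nor any integrability of the
  `u_n`; these are hypotheses of the theorems about it (with non-integrable fields the Bochner
  integrals are the junk value `0`).
* Not here (theorem-sized, wanted next): the proof of the existence fact (weak-\* sequential
  compactness of bounded sets of `M(T^d)`, Mathlib's `isCompact_setOf_finiteMeasure_le_of_compactSpace`,
  plus polarization) and `R = 0 ↔` strong `L²` convergence (Majda–Bertozzi Prop. 11.1).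

## References

* R. J. DiPerna, A. J. Majda, *Oscillations and concentrations in weak solutions of the
  incompressible fluid equations*, Comm. Math. Phys. 108 (1987) 667–689, §1, Thm. 1, (1.11)–(1.13).
* A. J. Majda, A. L. Bertozzi, *Vorticity and Incompressible Flow*, CUP 2002, §11.1,
  (11.10)–(11.24), Prop. 11.1–11.2.
* C. De Lellis, L. Székelyhidi Jr., *The h-principle and the equations of fluid dynamics*,
  Bull. AMS 49 (2012) 347–375, §2.2 (Reynolds stress `R ⪰ 0`, subsolutions, Def. 2.3), §2.4.
-/

open MeasureTheory Filter Set Topology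
open scoped InnerProductSpace ENNReal BoundedContinuousFunction

noncomputable section

namespace Literature.Analysis.FluidPDE

/-! ## Matrix-valued signed measures -/

/-- A **matrix-valued (finite, signed) measure** on a measurable space `X`, indexed by `d`: a
`d × d` matrix `R = (R i j)` of Mathlib signed measures `R i j : SignedMeasure X` (each
`R i j A ∈ ℝ`, countably additive on measurable sets, `0` on non-measurable ones). This is the
carrier of Reynolds stresses / defect measures `R ∈ M(X; ℝ^{d×d})` (De Lellis–Székelyhidi 2012,
§2.2 and §2.4). [cite: DeLellisSzekelyhidi2012BAMS, §2.2] -/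
abbrev MatrixMeasure (d X : Type*) [MeasurableSpace X] : Type _ :=
  Matrix d d (SignedMeasure X)

namespace MatrixMeasure

variable {d X : Type*} [MeasurableSpace X]

/-- The value of a matrix-valued measure on a set: the real matrix `(R i j A)_{i j}`. [folklore] -/
def eval (R : MatrixMeasure d X) (A : Set X) : Matrix d d ℝ :=
  Matrix.of fun i j => R i j A

/-- Entries of the value matrix. [folklore] -/
@[simp]
theorem eval_apply (R : MatrixMeasure d X) (A : Set X) (i j : d) : R.eval A i j = R i j A := rfl

/-- The value matrix of the zero matrix measure is `0`. [folklore] -/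
@[simp]
theorem eval_zero (A : Set X) : (0 : MatrixMeasure d X).eval A = 0 := by
  ext i j
  simp [eval]

/-- The value matrix is additive in the matrix measure. [folklore] -/
@[simp]
theorem eval_add (R S : MatrixMeasure d X) (A : Set X) : (R + S).eval A = R.eval A + S.eval A := by
  ext i j
  simp [eval]

/-- A matrix-valued measure is **positive semidefinite** if its value on every set is a positive
semidefinite matrix (Mathlib's `Matrix.PosSemidef`: symmetric with `ξᵀ (R i j A) ξ ≥ 0`), i.e.
`R` takes values in `S^{d×d}_{≥ 0}`; this is the sign condition `R ≥ 0` of a Reynolds stress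
(De Lellis–Székelyhidi 2012, §2.2: "`R ≥ 0`, i.e. `R` is a symmetric positive semidefinite
matrix"). Values on non-measurable sets are `0`, so no measurability proviso is needed.
[cite: DeLellisSzekelyhidi2012BAMS, §2.2] -/
def IsPosSemidef (R : MatrixMeasure d X) : Prop :=
  ∀ A : Set X, (R.eval A).PosSemidef

/-- The zero matrix measure is positive semidefinite. [folklore] -/
theorem isPosSemidef_zero : (0 : MatrixMeasure d X).IsPosSemidef := by
  intro A
  rw [eval_zero]
  exact Matrix.PosSemidef.zero

/-- Positive semidefinite matrix measures are symmetric: `R i j = R j i`. [folklore] -/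
theorem IsPosSemidef.symm {R : MatrixMeasure d X} (h : R.IsPosSemidef) (i j : d) : R i j = R j i := by
  refine VectorMeasure.ext fun A _ => ?_
  have h1 := (h A).1.apply i j
  simpa using h1.symm

/-- Diagonal entries of a positive semidefinite matrix measure are nonnegative on every set.
[folklore] -/
theorem IsPosSemidef.diag_nonneg {R : MatrixMeasure d X} (h : R.IsPosSemidef) (i : d) (A : Set X) :
    0 ≤ R i i A := by
  classical
  simpa using (h A).diag_nonneg (i := i)

/-- Sums of positive semidefinite matrix measures are positive semidefinite. [folklore] -/
theorem IsPosSemidef.add {R S : MatrixMeasure d X} (hR : R.IsPosSemidef) (hS : S.IsPosSemidef) :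
    (R + S).IsPosSemidef := by
  intro A
  rw [eval_add]
  exact (hR A).add (hS A)

/-! ### Absolutely continuous matrix measures -/

/-- The matrix measure `S μ` with matrix density `S : X → ℝ^{d×d}` with respect to a measure
`μ` (entrywise `μ.withDensityᵥ`; an entry that is not `μ`-integrable gives the junk value `0`):
the absolutely continuous Reynolds stresses `R = S dx`. [folklore] -/
def ofDensity (μ : Measure X) (S : X → Matrix d d ℝ) : MatrixMeasure d X :=
  Matrix.of fun i j => μ.withDensityᵥ fun x => S x i j

/-- Entries of `ofDensity`. [folklore] -/
@[simp]
theorem ofDensity_apply (μ : Measure X) (S : X → Matrix d d ℝ) (i j : d) :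
    ofDensity μ S i j = μ.withDensityᵥ fun x => S x i j := rfl

/-- **Integration against a measure with real density**: for `f ∈ L¹(μ)` and bounded measurable
`g`, `∫ g d(f μ) = ∫ g f dμ` (Jordan parts `f⁺ μ`, `f⁻ μ` of `μ.withDensityᵥ f` and Mathlib's
`integral_toSignedMeasure`). [folklore] -/
theorem signedMeasure_integral_withDensityᵥ {μ : Measure X} {f g : X → ℝ} (hf : Integrable f μ)
    (hg : AEStronglyMeasurable g μ) {C : ℝ} (hgC : ∀ x, ‖g x‖ ≤ C) :
    ∫ᵛ x, g x ∂<•(μ.withDensityᵥ f) = ∫ x, g x * f x ∂μ := by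
  haveI := isFiniteMeasure_withDensity_ofReal hf.2
  haveI := isFiniteMeasure_withDensity_ofReal hf.neg.2
  have hgi : ∀ (ν : Measure X) [IsFiniteMeasure ν], ν ≪ μ → ν.toSignedMeasure.Integrable g := by
    intro ν _ hν
    show Integrable g ν.toSignedMeasure.variation
    rw [Measure.variation_toSignedMeasure]
    exact Integrable.of_bound (hg.mono_ac hν) C (ae_of_all _ hgC)
  rw [withDensityᵥ_eq_withDensity_pos_part_sub_withDensity_neg_part hf,
    VectorMeasure.integral_sub_vectorMeasure (hgi _ (withDensity_absolutelyContinuous _ _))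
      (hgi _ (withDensity_absolutelyContinuous _ _)),
    VectorMeasure.integral_toSignedMeasure, VectorMeasure.integral_toSignedMeasure,
    integral_withDensity_eq_integral_toReal_smul₀ hf.aemeasurable.ennreal_ofReal
      (ae_of_all _ fun _ => ENNReal.ofReal_lt_top),
    integral_withDensity_eq_integral_toReal_smul₀ (f := fun x => ENNReal.ofReal (-f x))
      hf.aemeasurable.neg.ennreal_ofReal (ae_of_all _ fun _ => ENNReal.ofReal_lt_top)]
  simp only [ENNReal.toReal_ofReal', smul_eq_mul]
  rw [← integral_sub (hf.pos_part.mul_bdd hg (ae_of_all _ hgC))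
      (hf.neg_part.mul_bdd hg (ae_of_all _ hgC))]
  refine integral_congr_ae (ae_of_all _ fun x => ?_)
  show max (f x) 0 * g x - max (-f x) 0 * g x = g x * f x
  rw [← sub_mul, max_zero_sub_max_neg_zero_eq_self, mul_comm]

section Fintype

variable [Fintype d]

/-- The quadratic form of a positive semidefinite matrix measure is nonnegative on every set:
`0 ≤ ∑ᵢⱼ ξᵢ ξⱼ R i j A`, i.e. `ξᵀ R ξ` is a (positive) finite measure for every `ξ ∈ ℝ^d`.
[folklore] -/
theorem IsPosSemidef.sum_mul_mul_nonneg {R : MatrixMeasure d X} (h : R.IsPosSemidef) (ξ : d → ℝ)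
    (A : Set X) : 0 ≤ ∑ i, ∑ j, ξ i * ξ j * R i j A := by
  have h0 := (h A).dotProduct_mulVec_nonneg ξ
  simp only [dotProduct, Matrix.mulVec, star_trivial, eval_apply, Finset.mul_sum] at h0
  refine h0.trans_eq (Finset.sum_congr rfl fun i _ => Finset.sum_congr rfl fun j _ => ?_)
  ring

/-- The **total defect** (trace mass) of a matrix measure, `tr R (X) = ∑ᵢ R i i univ ∈ ℝ`; for
the Reynolds defect of `u_n ⇀ v` this is the `L²`-energy defect `lim ∫|u_n|² - ∫|v|²`
(Majda–Bertozzi 2002, (11.17)–(11.18)). [cite: MajdaBertozzi2002, §11.1 (11.18)] -/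
def traceMass (R : MatrixMeasure d X) : ℝ :=
  ∑ i, R i i univ

/-- The total defect of a positive semidefinite matrix measure is nonnegative. [folklore] -/
theorem IsPosSemidef.traceMass_nonneg {R : MatrixMeasure d X} (h : R.IsPosSemidef) :
    0 ≤ R.traceMass :=
  Finset.sum_nonneg fun i _ => h.diag_nonneg i univ

/-- The zero matrix measure has zero total defect. [folklore] -/
@[simp]
theorem traceMass_zero : (0 : MatrixMeasure d X).traceMass = 0 := by
  simp [traceMass]

/-- The **duality pairing** of a matrix field `G : X → ℝ^{d×d}` with a matrix measure,
`∫ G : dR := ∑ᵢⱼ ∫ G i j d(R i j)`, each entry integrated against the signed measure `R i j`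
with Mathlib's integral against a vector measure (`∫ᵛ x, · ∂<•(R i j)`; junk value `0` for an
entry that is not integrable w.r.t. the variation of `R i j`). This is the term `∫ ∇φ : dR`
through which a measure-valued Reynolds stress enters a weak momentum balance
(De Lellis–Székelyhidi 2012, §2.2, the averaged system for `(v̄, R)`; §2.4, Def. 2.7).
[cite: DeLellisSzekelyhidi2012BAMS, §2.2] -/
def pairing (R : MatrixMeasure d X) (G : X → Matrix d d ℝ) : ℝ :=
  ∑ i, ∑ j, ∫ᵛ x, G x i j ∂<•(R i j)

/-- The pairing with the zero matrix measure vanishes. [folklore] -/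
@[simp]
theorem pairing_zero_left (G : X → Matrix d d ℝ) : (0 : MatrixMeasure d X).pairing G = 0 := by
  simp [pairing]

/-- **Pairing with an absolutely continuous matrix measure**: for `μ`-integrable densities and a
bounded measurable matrix field, `∫ G : d(S μ) = ∫ (G : S) dμ = ∫ ∑ᵢⱼ Gᵢⱼ Sᵢⱼ dμ`. [folklore] -/
theorem pairing_ofDensity {μ : Measure X} {S G : X → Matrix d d ℝ}
    (hS : ∀ i j, Integrable (fun x => S x i j) μ) (hG : ∀ i j, AEStronglyMeasurable (fun x => G x i j) μ)
    {C : ℝ} (hGC : ∀ x i j, ‖G x i j‖ ≤ C) :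
    (ofDensity μ S).pairing G = ∫ x, ∑ i, ∑ j, G x i j * S x i j ∂μ := by
  have hint : ∀ i j, Integrable (fun x => G x i j * S x i j) μ := fun i j =>
    (hS i j).bdd_mul (hG i j) (ae_of_all _ fun x => hGC x i j)
  calc (ofDensity μ S).pairing G = ∑ i, ∑ j, ∫ x, G x i j * S x i j ∂μ := by
        simp only [pairing, ofDensity_apply]
        exact Finset.sum_congr rfl fun i _ => Finset.sum_congr rfl fun j _ =>
          signedMeasure_integral_withDensityᵥ (hS i j) (hG i j) fun x => hGC x i j
    _ = ∑ i, ∫ x, ∑ j, G x i j * S x i j ∂μ :=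
        Finset.sum_congr rfl fun i _ => (integral_finsetSum _ fun j _ => hint i j).symm
    _ = ∫ x, ∑ i, ∑ j, G x i j * S x i j ∂μ :=
        (integral_finsetSum _ fun i _ => integrable_finsetSum _ fun j _ => hint i j).symm

end Fintype

/-! ### Signed measures have finite variation; integrals of constants -/

/-- The variation measure of a (finite) signed measure is finite: by the Jordan decomposition
`s = s⁺ - s⁻` and `|s| ≤ s⁺ + s⁻` (Mathlib's `VectorMeasure.variation`; not yet an instance in
Mathlib — stated as a theorem and invoked with `haveI` where constants are integrated). [folklore] -/
theorem isFiniteMeasure_variation (s : SignedMeasure X) : IsFiniteMeasure s.variation := by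
  set j := s.toJordanDecomposition with hj
  have hs : s = j.posPart.toSignedMeasure - j.negPart.toSignedMeasure :=
    (SignedMeasure.toSignedMeasure_toJordanDecomposition s).symm
  refine ⟨?_⟩
  calc s.variation univ
      = (j.posPart.toSignedMeasure - j.negPart.toSignedMeasure).variation univ := by rw [← hs]
    _ ≤ (j.posPart.toSignedMeasure.variation + j.negPart.toSignedMeasure.variation) univ :=
        Measure.le_iff'.1 (VectorMeasure.variation_sub_le) univ
    _ = j.posPart univ + j.negPart univ := by simp
    _ < ∞ := ENNReal.add_lt_top.2 ⟨measure_lt_top _ _, measure_lt_top _ _⟩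

/-- Constants integrate against a signed measure to `s univ * c`. [folklore] -/
theorem signedMeasure_integral_const (s : SignedMeasure X) (c : ℝ) :
    ∫ᵛ _x, c ∂<•s = s univ * c := by
  haveI := isFiniteMeasure_variation s
  rw [VectorMeasure.integral_const]
  simp

/-- In particular `∫ 1 ds = s univ`. [folklore] -/
@[simp]
theorem signedMeasure_integral_one (s : SignedMeasure X) : ∫ᵛ _x, (1 : ℝ) ∂<•s = s univ := by
  rw [signedMeasure_integral_const, mul_one]

/-- **A finite signed Borel measure is determined by the integrals of bounded continuous
functions** (on any space where indicators of closed sets are decreasing limits of bounded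
continuous functions, e.g. metrizable spaces): Jordan decomposition plus Mathlib's
`ext_of_forall_integral_eq_of_IsFiniteMeasure` applied to `s⁺ + t⁻ = t⁺ + s⁻`. [folklore] -/
theorem signedMeasure_ext_of_forall_integral_eq {Y : Type*} [MeasurableSpace Y]
    [TopologicalSpace Y] [HasOuterApproxClosed Y] [BorelSpace Y] {s t : SignedMeasure Y}
    (h : ∀ φ : Y →ᵇ ℝ, ∫ᵛ x, φ x ∂<•s = ∫ᵛ x, φ x ∂<•t) : s = t := by
  set js := s.toJordanDecomposition
  set jt := t.toJordanDecomposition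
  have hs : s = js.posPart.toSignedMeasure - js.negPart.toSignedMeasure :=
    (SignedMeasure.toSignedMeasure_toJordanDecomposition s).symm
  have ht : t = jt.posPart.toSignedMeasure - jt.negPart.toSignedMeasure :=
    (SignedMeasure.toSignedMeasure_toJordanDecomposition t).symm
  have hint : ∀ (μ : Measure Y) [IsFiniteMeasure μ] (φ : Y →ᵇ ℝ), μ.toSignedMeasure.Integrable φ := by
    intro μ _ φ
    show Integrable (⇑φ) μ.toSignedMeasure.variation
    rw [Measure.variation_toSignedMeasure]
    exact BoundedContinuousFunction.integrable μ φ
  have hsplit : ∀ (μ ν : Measure Y) [IsFiniteMeasure μ] [IsFiniteMeasure ν] (φ : Y →ᵇ ℝ),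
      ∫ᵛ x, φ x ∂<•(μ.toSignedMeasure - ν.toSignedMeasure) = (∫ x, φ x ∂μ) - ∫ x, φ x ∂ν := by
    intro μ ν _ _ φ
    rw [VectorMeasure.integral_sub_vectorMeasure (hint μ φ) (hint ν φ),
      VectorMeasure.integral_toSignedMeasure, VectorMeasure.integral_toSignedMeasure]
  have key : js.posPart + jt.negPart = jt.posPart + js.negPart := by
    refine ext_of_forall_integral_eq_of_IsFiniteMeasure fun φ => ?_
    have hφ := h φ
    rw [hs, ht, hsplit, hsplit] at hφ
    rw [integral_add_measure (BoundedContinuousFunction.integrable _ φ)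
        (BoundedContinuousFunction.integrable _ φ),
      integral_add_measure (BoundedContinuousFunction.integrable _ φ)
        (BoundedContinuousFunction.integrable _ φ)]
    linarith
  have key' : (js.posPart + jt.negPart).toSignedMeasure = (jt.posPart + js.negPart).toSignedMeasure :=
    Measure.toSignedMeasure_eq_toSignedMeasure_iff.2 key
  rw [Measure.toSignedMeasure_add, Measure.toSignedMeasure_add] at key'
  rw [hs, ht]
  exact sub_eq_sub_iff_add_eq_add.2 key'

/-- A matrix measure on a metrizable Borel space is determined by its pairings with continuous
bounded scalar test functions entrywise. [folklore] -/
theorem ext_of_forall_integral_eq {Y : Type*} [MeasurableSpace Y] [TopologicalSpace Y]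
    [HasOuterApproxClosed Y] [BorelSpace Y] {R S : MatrixMeasure d Y}
    (h : ∀ φ : Y →ᵇ ℝ, ∀ i j, ∫ᵛ x, φ x ∂<•(R i j) = ∫ᵛ x, φ x ∂<•(S i j)) : R = S :=
  Matrix.ext fun i j => signedMeasure_ext_of_forall_integral_eq fun φ => h φ i j

end MatrixMeasure

/-! ## Reynolds defect measures on the flat torus -/

namespace Torus

variable {d : Type*} [Fintype d]

/-- **Reynolds (weak-\*) defect measure.** For velocity fields `u_n, v : T^d → ℝ^d` on the flat
unit torus, `R = (R i j)` is *the Reynolds defect of `(u_n)` about `v`* if `R` is a positive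
semidefinite (hence symmetric, finite, Borel) matrix-valued measure on `T^d` and
`u_n ⊗ u_n dx ⇀* v ⊗ v dx + R` in the sense of measures: for every continuous `φ : T^d → ℝ` and
all `i j`,
`∫ φ (u_n)ᵢ (u_n)ⱼ dx ⟶ ∫ φ vᵢ vⱼ dx + ∫ φ d(R i j)` as `n → ∞`.
When `u_n ⇀ v` weakly in `L²(T^d)` this says `R = w*-lim (u_n - v) ⊗ (u_n - v) dx`, the
Reynolds stress of the weak limit (De Lellis–Székelyhidi 2012, §2.2, `R = avg((v-v̄)⊗(v-v̄)) ≥ 0`,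
and §2.4: the stress of the limit "is a measure rather than a locally integrable function,
because of possible `L²` concentrations"; DiPerna–Majda 1987, Thm. 1 and (1.11) with
`g = v⊗v`; its trace is the weak-\* defect measure `σ` of Majda–Bertozzi 2002, (11.18)).
The predicate records neither the weak convergence `u_n ⇀ v` nor integrability of the `u_n`
(hypotheses of the theorems below; Bochner integrals of non-integrable functions are `0`).
[cite: DiPernaMajda1987, §1 Thm. 1 and (1.11)–(1.13)] -/
def IsReynoldsDefectOf (u : ℕ → UnitAddTorus d → EuclideanSpace ℝ d)
    (v : UnitAddTorus d → EuclideanSpace ℝ d) (R : MatrixMeasure d (UnitAddTorus d)) : Prop :=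
  R.IsPosSemidef ∧
    ∀ φ : UnitAddTorus d → ℝ, Continuous φ → ∀ i j : d,
      Tendsto (fun n => ∫ x, φ x * (u n x i * u n x j)) atTop
        (𝓝 ((∫ x, φ x * (v x i * v x j)) + ∫ᵛ x, φ x ∂<•(R i j)))

namespace IsReynoldsDefectOf

variable {u : ℕ → UnitAddTorus d → EuclideanSpace ℝ d} {v : UnitAddTorus d → EuclideanSpace ℝ d}
  {R : MatrixMeasure d (UnitAddTorus d)}

/-- A Reynolds defect measure is positive semidefinite. [folklore] -/
theorem isPosSemidef (h : IsReynoldsDefectOf u v R) : R.IsPosSemidef := h.1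

/-- A Reynolds defect measure is symmetric, `R i j = R j i`. [folklore] -/
theorem symm (h : IsReynoldsDefectOf u v R) (i j : d) : R i j = R j i := h.1.symm i j

/-- The defining convergence `∫ φ (u_n)ᵢ (u_n)ⱼ → ∫ φ vᵢ vⱼ + ∫ φ d(R i j)`. [folklore] -/
theorem tendsto (h : IsReynoldsDefectOf u v R) {φ : UnitAddTorus d → ℝ} (hφ : Continuous φ)
    (i j : d) :
    Tendsto (fun n => ∫ x, φ x * (u n x i * u n x j)) atTop
      (𝓝 ((∫ x, φ x * (v x i * v x j)) + ∫ᵛ x, φ x ∂<•(R i j))) :=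
  h.2 φ hφ i j

/-- Testing with `φ = 1`: `∫ (u_n)ᵢ (u_n)ⱼ → ∫ vᵢ vⱼ + R i j (T^d)`. [folklore] -/
theorem tendsto_integral_mul (h : IsReynoldsDefectOf u v R) (i j : d) :
    Tendsto (fun n => ∫ x, u n x i * u n x j) atTop (𝓝 ((∫ x, v x i * v x j) + R i j univ)) := by
  have := h.tendsto continuous_const (φ := fun _ => (1 : ℝ)) i j
  simpa only [one_mul, MatrixMeasure.signedMeasure_integral_one] using this

/-- **The Reynolds defect is determined by the sequence and its weak limit**: two defect
measures of the same `(u_n)` about the same `v` coincide (limits are unique and a finite signed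
Borel measure on the metrizable torus is determined by the integrals of continuous functions).
[folklore] -/
theorem unique {R' : MatrixMeasure d (UnitAddTorus d)} (h : IsReynoldsDefectOf u v R)
    (h' : IsReynoldsDefectOf u v R') : R = R' :=
  MatrixMeasure.ext_of_forall_integral_eq fun φ i j =>
    add_left_cancel (tendsto_nhds_unique (h.tendsto φ.continuous i j) (h'.tendsto φ.continuous i j))

end IsReynoldsDefectOf

/-- A constant sequence `u_n = v` has zero Reynolds defect. [folklore] -/
theorem isReynoldsDefectOf_const (v : UnitAddTorus d → EuclideanSpace ℝ d) :
    IsReynoldsDefectOf (fun _ => v) v 0 := by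
  refine ⟨MatrixMeasure.isPosSemidef_zero, fun φ _ i j => ?_⟩
  simp only [Matrix.zero_apply, VectorMeasure.integral_zero_vectorMeasure, add_zero]
  exact tendsto_const_nhds

/-- **Existence of the Reynolds defect measure along a subsequence** (named fact). If
`u_n : T^d → ℝ^d` are `L²` fields with `sup_n ∫ |u_n|² < ∞` converging weakly in `L²` to
`v ∈ L²` (pairings with smooth fields converge), then a subsequence has a Reynolds defect
measure `R ⪰ 0`: `u_{φ(n)} ⊗ u_{φ(n)} dx ⇀* v ⊗ v dx + R`. This is DiPerna–Majda's generalized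
Young measure theorem (Thm. 1, any `L²`-bounded family on `Ω ⊂ ℝⁿ × ℝ`) read on the compact
torus for the quadratic observables `g(v) = vᵢ vⱼ` of their class (1.9), (1.11)–(1.13);
equivalently: bounded sets of `M(T^d) = C(T^d)^*` are weak-\* sequentially compact
(Majda–Bertozzi 2002, Lemma 10.1 and (11.12)–(11.13), (11.18)–(11.20) for the positivity),
applied to the finitely many positive measures `⟨u_n - v, ξ⟩² dx`, `ξ ∈ {eᵢ, eᵢ + eⱼ}`, and
polarization. Specialisation to `T^d` of the printed `ℝⁿ × ℝ` statement.
[cite: DiPernaMajda1987, §1 Thm. 1] -/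
def exists_isReynoldsDefectOf_subseq (d : Type*) [Fintype d] : Prop :=
  ∀ (u : ℕ → UnitAddTorus d → EuclideanSpace ℝ d) (v : UnitAddTorus d → EuclideanSpace ℝ d)
    (C : ℝ), (∀ n, MemLp (u n) 2 volume) → (∀ n, ∫ x, ‖u n x‖ ^ 2 ≤ C) → MemLp v 2 volume →
    (∀ w : UnitAddTorus d → EuclideanSpace ℝ d, FunctionSpaces.Torus.IsSmooth w →
      Tendsto (fun n => ∫ x, ⟪w x, u n x⟫_ℝ) atTop (𝓝 (∫ x, ⟪w x, v x⟫_ℝ))) →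
    ∃ φ : ℕ → ℕ, StrictMono φ ∧ ∃ R : MatrixMeasure d (UnitAddTorus d),
      IsReynoldsDefectOf (u ∘ φ) v R

/-! ### The energy defect is the trace mass -/

section Energy

/-- Components of an `L²` field are in `L²`. [folklore] -/
theorem memLp_two_apply {w : UnitAddTorus d → EuclideanSpace ℝ d}
    (hw : MemLp w 2 volume) (i : d) : MemLp (fun x => w x i) 2 volume :=
  (EuclideanSpace.proj i : EuclideanSpace ℝ d →L[ℝ] ℝ).comp_memLp' hw

/-- Products of components of an `L²` field are integrable. [folklore] -/
theorem integrable_apply_mul_apply_of_memLp_two {w : UnitAddTorus d → EuclideanSpace ℝ d}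
    (hw : MemLp w 2 volume) (i j : d) : Integrable (fun x => w x i * w x j) volume :=
  (memLp_two_apply hw i).integrable_mul (memLp_two_apply hw j)

/-- `∫ |w|² = ∑ᵢ ∫ wᵢ²` for an `L²` field on the torus. [folklore] -/
theorem integral_norm_sq_eq_sum_of_memLp_two {w : UnitAddTorus d → EuclideanSpace ℝ d} (hw : MemLp w 2 volume) :
    ∫ x, ‖w x‖ ^ 2 = ∑ i, ∫ x, w x i * w x i := by
  rw [← integral_finsetSum _ fun i _ => integrable_apply_mul_apply_of_memLp_two hw i i]
  refine integral_congr_ae (Eventually.of_forall fun x => ?_)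
  show ‖w x‖ ^ 2 = ∑ i, w x i * w x i
  rw [EuclideanSpace.real_norm_sq_eq]
  exact Finset.sum_congr rfl fun i _ => pow_two _

/-- **The `L²`-energy defect is the total mass of the trace of the Reynolds defect measure**:
if `R` is the Reynolds defect of `(u_n)` about `v` (all fields in `L²`), then
`∫ |u_n|² dx ⟶ ∫ |v|² dx + tr R (T^d)` (Majda–Bertozzi 2002, (11.16)–(11.18): the weak-\*
defect measure `σ = μ - |v|² dx` with `|v^ε|² dx ⇀ μ`; here `σ = tr R`).
[cite: MajdaBertozzi2002, §11.1 (11.18)] -/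
theorem IsReynoldsDefectOf.tendsto_integral_norm_sq {u : ℕ → UnitAddTorus d → EuclideanSpace ℝ d}
    {v : UnitAddTorus d → EuclideanSpace ℝ d} {R : MatrixMeasure d (UnitAddTorus d)}
    (h : IsReynoldsDefectOf u v R) (hu : ∀ n, MemLp (u n) 2 volume) (hv : MemLp v 2 volume) :
    Tendsto (fun n => ∫ x, ‖u n x‖ ^ 2) atTop (𝓝 ((∫ x, ‖v x‖ ^ 2) + R.traceMass)) := by
  have hlim : (∫ x, ‖v x‖ ^ 2) + R.traceMass = ∑ i, ((∫ x, v x i * v x i) + R i i univ) := by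
    rw [integral_norm_sq_eq_sum_of_memLp_two hv, MatrixMeasure.traceMass, Finset.sum_add_distrib]
  have hfun : (fun n => ∫ x, ‖u n x‖ ^ 2) = fun n => ∑ i, ∫ x, u n x i * u n x i :=
    funext fun n => integral_norm_sq_eq_sum_of_memLp_two (hu n)
  rw [hlim, hfun]
  exact tendsto_finsetSum _ fun i _ => h.tendsto_integral_mul i i

end Energy

/-! ### Measure-valued Reynolds stress in the weak momentum balance -/

section Pairing

variable [DecidableEq d]

/-- The **defect term of the momentum balance**, `∫ ∇w : dR := ∑ᵢⱼ ∫ ∂ⱼ wᵢ d(R i j)`, for a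
vector field `w : T^d → ℝ^d` (meant for smooth `w`) and a matrix measure `R` on `T^d`: the
pairing of `R` with the matrix field `(∇w)ᵢⱼ = ∂ⱼ wᵢ`. For an absolutely continuous symmetric
stress `R = S dx` stored by columns as in `Torus.IsEulerReynoldsOn` this is
`∫ ∑ⱼ ⟪S^{(j)}, ∂ⱼ w⟫ dx = -∫ ⟪div S, w⟫ dx` (`Torus.integral_inner_tensorDivergence`).
(De Lellis–Székelyhidi 2012, §2.2, the averaged system for `(v̄, R)` tested against `w`; §2.4,
Def. 2.7.) [cite: DeLellisSzekelyhidi2012BAMS, §2.2] -/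
def defectPairing (R : MatrixMeasure d (UnitAddTorus d))
    (w : UnitAddTorus d → EuclideanSpace ℝ d) : ℝ :=
  R.pairing fun x => Matrix.of fun i j => FunctionSpaces.Torus.partialDeriv j w x i

/-- The defect term of the zero stress vanishes. [folklore] -/
@[simp]
theorem defectPairing_zero_left (w : UnitAddTorus d → EuclideanSpace ℝ d) :
    defectPairing (0 : MatrixMeasure d (UnitAddTorus d)) w = 0 :=
  MatrixMeasure.pairing_zero_left _

/-- **Consistency with the classical stress term.** For a smooth stress stored by columns,
`S x j = S(x) eⱼ` (the convention of `Torus.IsEulerReynoldsOn`), the defect term of the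
absolutely continuous matrix measure `(Sᵢⱼ dx)` against a smooth `w` is the classical
`∫ ∑ⱼ ⟪S^{(j)}, ∂ⱼ w⟫ dx` (`= -∫ ⟪div S, w⟫ dx` by `Torus.integral_inner_tensorDivergence`).
[folklore] -/
theorem defectPairing_ofDensity {S : UnitAddTorus d → d → EuclideanSpace ℝ d}
    {w : UnitAddTorus d → EuclideanSpace ℝ d} (hS : FunctionSpaces.Torus.IsSmooth S)
    (hw : FunctionSpaces.Torus.IsSmooth w) :
    defectPairing (MatrixMeasure.ofDensity volume fun x => Matrix.of fun i j => S x j i) w =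
      ∫ x, ∑ j, ⟪S x j, FunctionSpaces.Torus.partialDeriv j w x⟫_ℝ := by
  -- a uniform bound for the (continuous) entries `∂ⱼ wᵢ` on the compact torus
  obtain ⟨C, hC⟩ := (HasCompactSupport.of_compactSpace
      (fun x => ∑ i, ∑ j, ‖FunctionSpaces.Torus.partialDeriv j w x i‖)).exists_bound_of_continuous
    (continuous_finsetSum _ fun i _ => continuous_finsetSum _ fun j _ =>
      ((hw.partialDeriv j).apply i).continuous.norm)
  have hC' : ∀ x i j, ‖FunctionSpaces.Torus.partialDeriv j w x i‖ ≤ C := by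
    intro x i j
    refine le_trans ?_ ((Real.le_norm_self _).trans (hC x))
    refine le_trans ?_ (Finset.single_le_sum (f := fun i => ∑ j, ‖FunctionSpaces.Torus.partialDeriv j w x i‖)
      (fun i _ => Finset.sum_nonneg fun j _ => norm_nonneg _) (Finset.mem_univ i))
    exact Finset.single_le_sum (f := fun j => ‖FunctionSpaces.Torus.partialDeriv j w x i‖)
      (fun j _ => norm_nonneg _) (Finset.mem_univ j)
  have hcol : ∀ j, FunctionSpaces.Torus.IsSmooth fun x => S x j := fun j =>
    hS.comp_clm (ContinuousLinearMap.proj (R := ℝ) (φ := fun _ : d => EuclideanSpace ℝ d) j)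
  unfold defectPairing
  rw [MatrixMeasure.pairing_ofDensity (S := fun x => Matrix.of fun i j => S x j i)
    (G := fun x => Matrix.of fun i j => FunctionSpaces.Torus.partialDeriv j w x i)
    (fun i j => ((hcol j).apply i).integrable)
    (fun i j => ((hw.partialDeriv j).apply i).continuous.aestronglyMeasurable) (C := C)
    (fun x i j => by simpa using hC' x i j)]
  refine integral_congr_ae (ae_of_all _ fun x => ?_)
  simp only [Matrix.of_apply, PiLp.inner_apply, RCLike.inner_apply, conj_trivial]
  rw [Finset.sum_comm]

/-- **Stationary Euler–Reynolds subsolution with measure-valued stress.** On `T^d`, a velocity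
`v ∈ L²`, a source `f` and a positive semidefinite matrix measure `R` solve
`div (v ⊗ v + R) + ∇p = f`, `div v = 0` weakly (pressure eliminated by divergence-free test
fields): `v` is weakly divergence free and for every smooth divergence-free `w : T^d → ℝ^d`,
`∫ (⟪v, (v·∇)w⟫ + ⟪f, w⟫) dx + ∫ ∇w : dR = 0`
(since `∫ ⟪div(v⊗v), w⟫ = -∫ ⟪v, (v·∇)w⟫` and `∫ ⟪div R, w⟫ = -∫ ∇w : dR`; the sign convention of
`Torus.IsWeakNSSolutionOn` with `ν = 0`, no time dependence, plus the defect term). This is the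
stationary, forced, measure-stress form of the subsolutions of De Lellis–Székelyhidi 2012, §2.2
and Def. 2.3 (there with `R ∈ L¹` absorbed into `ū = v⊗v + R - (2/n) ē I`), the expected weak
limit of `L²`-bounded steady Navier–Stokes states as `ν → 0`. [cite: DeLellisSzekelyhidi2012BAMS, §2.2 Def. 2.3] -/
def IsSteadyEulerReynoldsSubsolution (f v : UnitAddTorus d → EuclideanSpace ℝ d)
    (R : MatrixMeasure d (UnitAddTorus d)) : Prop :=
  MemLp v 2 volume ∧ FunctionSpaces.Torus.IsWeaklyDivFree v ∧ R.IsPosSemidef ∧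
    ∀ w : UnitAddTorus d → EuclideanSpace ℝ d, FunctionSpaces.Torus.IsSmooth w →
      FunctionSpaces.Torus.IsDivFree w →
        (∫ x, (⟪v x, FunctionSpaces.Torus.convect v w x⟫_ℝ + ⟪f x, w x⟫_ℝ)) + defectPairing R w = 0

end Pairing

end Torus

end Literature.Analysis.FluidPDE
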